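import Mathlib

/-!
# The box-union covariance inequality for log-supermodular weights — definitions
(blind cell PercRepro2, mine-1 g36; paper proof proofs/MINE1-BOXUNION.md; part 1 of 3)

Setting for `BoxUnion.lean`: a finite distributive lattice `α`, a nonnegative log-supermodular
weight `ν` (`ν x * ν y ≤ ν (x ⊓ y) * ν (x ⊔ y)`), monotone `f g`, and the union of boxes
`boxUnion a b = ↓a ∪ ↑b`.  This file sets up the collapsing lattice homomorphism
`rho a b x = (x ⊓ b, x ⊔ a)` (whose fibres are sublattices, with `↓a`, `↑b` unions of fibres and
`[b, a]` a single fibre), the pointwise four-functions conditions for "support-monotone"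
nonnegative functions, the fibres `fib`, fibre masses `M`, fibre sums `S`, fibre means `fmean`
and the fibre-mean function `F x = E[f ∣ fibre of x]`.  The inequalities live in
`BoxUnionFKG.lean`, the theorem in `BoxUnion.lean`.
-/

namespace Summit.Ventures.PercRepro2

namespace BoxUnion

open Finset

open scoped Classical

noncomputable section

section Lattice

variable {α : Type*} [DistribLattice α]

/-! ### The collapsing homomorphism `ρ x = (x ⊓ b, x ⊔ a)` -/

/-- The collapsing lattice homomorphism `x ↦ (x ⊓ b, x ⊔ a)`; its fibres are sublattices, `↓a` and
`↑b` are unions of fibres, and `[b, a]` is a single fibre when `b ≤ a`. -/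
def rho (a b x : α) : α × α := (x ⊓ b, x ⊔ a)

/-- `ρ` preserves meets. -/
lemma rho_inf (a b x y : α) : rho a b (x ⊓ y) = rho a b x ⊓ rho a b y := by
  simp only [rho, Prod.mk_inf_mk]
  rw [inf_inf_distrib_right, sup_inf_right]

/-- `ρ` preserves joins. -/
lemma rho_sup (a b x y : α) : rho a b (x ⊔ y) = rho a b x ⊔ rho a b y := by
  simp only [rho, Prod.mk_sup_mk]
  rw [inf_sup_right, sup_sup_distrib_right]

/-- `ρ` is monotone. -/
lemma rho_mono (a b : α) : Monotone (rho a b) := fun _ _ h =>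
  Prod.mk_le_mk.mpr ⟨inf_le_inf_right b h, sup_le_sup_right h a⟩

/-- `x ≤ a` iff `ρ x ≤ ρ a`. -/
lemma rho_le_rho_a_iff (a b x : α) : rho a b x ≤ rho a b a ↔ x ≤ a := by
  constructor
  · intro h
    have h2 := (Prod.mk_le_mk.mp h).2
    rw [sup_idem] at h2
    exact le_sup_left.trans h2
  · exact fun h => rho_mono a b h

/-- `b ≤ x` iff `ρ b ≤ ρ x`. -/
lemma rho_b_le_rho_iff (a b x : α) : rho a b b ≤ rho a b x ↔ b ≤ x := by
  constructor
  · intro h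
    have h1 := (Prod.mk_le_mk.mp h).1
    rw [inf_idem] at h1
    exact h1.trans inf_le_left
  · exact fun h => rho_mono a b h

/-- When `b ≤ a`, the fibre of `a` (= the fibre of `b`) is the interval `[b, a]`. -/
lemma rho_eq_rho_a_iff {a b : α} (hba : b ≤ a) (x : α) :
    rho a b x = rho a b a ↔ (b ≤ x ∧ x ≤ a) := by
  simp only [rho, Prod.mk.injEq, sup_idem, inf_eq_right.mpr hba]
  constructor
  · rintro ⟨h1, h2⟩
    exact ⟨h1 ▸ inf_le_left, le_sup_left.trans h2.le⟩
  · rintro ⟨h1, h2⟩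
    exact ⟨inf_eq_right.mpr h1, sup_eq_right.mpr h2⟩

/-- For `b ≤ a` and `b ≤ x`: `ρ a ≤ ρ x`. -/
lemma rho_a_le_rho_of_b_le {a b x : α} (hba : b ≤ a) (hx : b ≤ x) : rho a b a ≤ rho a b x := by
  simp only [rho, sup_idem, inf_eq_right.mpr hba, Prod.mk_le_mk]
  exact ⟨le_inf hx le_rfl, le_sup_right⟩

/-- For `x ≤ a`: `ρ x ≤ ρ a`. -/
lemma rho_le_rho_a_of_le {a b x : α} (hx : x ≤ a) : rho a b x ≤ rho a b a :=
  (rho_le_rho_a_iff a b x).mpr hx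

/-- The union of boxes `U = ↓a ∪ ↑b`, as a set. -/
def boxUnion (a b : α) : Set α := {x | x ≤ a ∨ b ≤ x}

/-- Membership in `boxUnion a b`. -/
lemma mem_boxUnion {a b x : α} : x ∈ boxUnion a b ↔ (x ≤ a ∨ b ≤ x) := Iff.rfl

/-- The join of two points of positive weight has positive weight (log-supermodularity). -/
lemma nu_sup_pos {ν : α → ℝ} (hν : ∀ x, 0 ≤ ν x)
    (hlsm : ∀ x y, ν x * ν y ≤ ν (x ⊓ y) * ν (x ⊔ y)) {x y : α} (hx : 0 < ν x) (hy : 0 < ν y) : 0 < ν (x ⊔ y) := by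
  have h : 0 < ν (x ⊓ y) * ν (x ⊔ y) := lt_of_lt_of_le (mul_pos hx hy) (hlsm x y)
  rcases (hν (x ⊔ y)).lt_or_eq with h' | h'
  · exact h'
  · rw [← h', mul_zero] at h
    exact absurd h (lt_irrefl 0)

/-! ### Pointwise four-functions conditions for support-monotone nonnegative functions -/

section Pointwise

variable {ν φ ψ : α → ℝ}

/-- Pointwise four-functions condition for two support-monotone nonnegative functions. -/
lemma key_two (hν : ∀ x, 0 ≤ ν x) (hlsm : ∀ x y, ν x * ν y ≤ ν (x ⊓ y) * ν (x ⊔ y))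
    (hφ0 : ∀ x, 0 ≤ φ x)
    (hψ0 : ∀ x, 0 ≤ ψ x) (hφ : ∀ x y, 0 < ν x → 0 < ν y → φ x ≤ φ (x ⊔ y))
    (hψ : ∀ x y, 0 < ν x → 0 < ν y → ψ x ≤ ψ (x ⊔ y)) (x y : α) :
    ν x * φ x * (ν y * ψ y) ≤ ν (x ⊓ y) * (ν (x ⊔ y) * (φ (x ⊔ y) * ψ (x ⊔ y))) := by
  rcases (hν x).lt_or_eq with hx | hx
  · rcases (hν y).lt_or_eq with hy | hy
    · have h1 : φ x ≤ φ (x ⊔ y) := hφ x y hx hy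
      have h2 : ψ y ≤ ψ (x ⊔ y) := by rw [sup_comm]; exact hψ y x hy hx
      calc ν x * φ x * (ν y * ψ y) = ν x * ν y * (φ x * ψ y) := by ring
        _ ≤ ν (x ⊓ y) * ν (x ⊔ y) * (φ (x ⊔ y) * ψ (x ⊔ y)) :=
            mul_le_mul (hlsm x y) (mul_le_mul h1 h2 (hψ0 y) (hφ0 _))
              (mul_nonneg (hφ0 x) (hψ0 y)) (mul_nonneg (hν _) (hν _))
        _ = ν (x ⊓ y) * (ν (x ⊔ y) * (φ (x ⊔ y) * ψ (x ⊔ y))) := by ring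
    · rw [← hy, zero_mul, mul_zero]
      exact mul_nonneg (hν _) (mul_nonneg (hν _) (mul_nonneg (hφ0 _) (hψ0 _)))
  · rw [← hx, zero_mul, zero_mul]
    exact mul_nonneg (hν _) (mul_nonneg (hν _) (mul_nonneg (hφ0 _) (hψ0 _)))

/-- Pointwise four-functions condition with the function on the left only. -/
lemma key_left (hν : ∀ x, 0 ≤ ν x) (hlsm : ∀ x y, ν x * ν y ≤ ν (x ⊓ y) * ν (x ⊔ y))
    (hφ0 : ∀ x, 0 ≤ φ x)
    (hφ : ∀ x y, 0 < ν x → 0 < ν y → φ x ≤ φ (x ⊔ y)) (x y : α) :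
    ν x * φ x * ν y ≤ ν (x ⊓ y) * (ν (x ⊔ y) * φ (x ⊔ y)) := by
  have := key_two hν hlsm hφ0 (fun _ => zero_le_one) hφ
    (fun _ _ _ _ => le_rfl : ∀ x y, 0 < ν x → 0 < ν y →
      (fun _ => (1 : ℝ)) x ≤ (fun _ => (1 : ℝ)) (x ⊔ y)) x y
  simpa using this

/-- Pointwise four-functions condition with the function on the right only. -/
lemma key_right (hν : ∀ x, 0 ≤ ν x) (hlsm : ∀ x y, ν x * ν y ≤ ν (x ⊓ y) * ν (x ⊔ y))
    (hψ0 : ∀ x, 0 ≤ ψ x)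
    (hψ : ∀ x y, 0 < ν x → 0 < ν y → ψ x ≤ ψ (x ⊔ y)) (x y : α) :
    ν x * (ν y * ψ y) ≤ ν (x ⊓ y) * (ν (x ⊔ y) * ψ (x ⊔ y)) := by
  have := key_two hν hlsm (fun _ => zero_le_one) hψ0
    (fun _ _ _ _ => le_rfl : ∀ x y, 0 < ν x → 0 < ν y →
      (fun _ => (1 : ℝ)) x ≤ (fun _ => (1 : ℝ)) (x ⊔ y)) hψ x y
  simpa using this

end Pointwise

end Lattice

section Sums

variable {α : Type*} [DistribLattice α] [Fintype α]

/-- The `ν`-mean `(∑ ν f) / (∑ ν)` of `f`. -/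
def mean (ν f : α → ℝ) : ℝ := (∑ x, ν x * f x) / ∑ x, ν x

/-- The restricted covariance `∑_{x ∈ P} ν x (f x - m)(g x - m')`. -/
def phiOn (ν f g : α → ℝ) (m m' : ℝ) (P : α → Prop) [DecidablePred P] : ℝ :=
  ∑ x, if P x then ν x * ((f x - m) * (g x - m')) else 0

/-! ### Fibres, fibre masses and fibre means -/

variable (ν f : α → ℝ) (a b : α)

/-- The fibre of `k` under `ρ`. -/
def fib (k : α × α) : Finset α := univ.filter (fun x => rho a b x = k)

/-- The fibre mass `∑_{ρ x = k} ν x`. -/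
def M (k : α × α) : ℝ := ∑ x ∈ fib a b k, ν x

/-- The fibre sum `∑_{ρ x = k} ν x * f x`. -/
def S (k : α × α) : ℝ := ∑ x ∈ fib a b k, ν x * f x

/-- The fibre mean of `f` (`0` on a massless fibre, by the convention `r / 0 = 0`). -/
def fmean (k : α × α) : ℝ := S ν f a b k / M ν a b k

/-- The fibre-mean function on `α`: `F x = E[f ∣ fibre of x]`. -/
def F (x : α) : ℝ := fmean ν f a b (rho a b x)

variable {ν f a b}

/-- `x ∈ fib k ↔ ρ x = k`. -/
lemma mem_fib {k : α × α} {x : α} : x ∈ fib a b k ↔ rho a b x = k := by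
  simp [fib]

/-- Fibre masses as sums with an indicator. -/
lemma M_eq (k : α × α) : M ν a b k = ∑ x, if rho a b x = k then ν x else 0 := by
  rw [M, fib, sum_filter]

/-- Fibre sums as sums with an indicator. -/
lemma S_eq (k : α × α) : S ν f a b k = ∑ x, if rho a b x = k then ν x * f x else 0 := by
  rw [S, fib, sum_filter]

/-- Fibre masses are nonnegative. -/
lemma M_nonneg (hν : ∀ x, 0 ≤ ν x) (k : α × α) : 0 ≤ M ν a b k :=
  sum_nonneg fun x _ => hν x

/-- Fibre sums of a nonnegative function are nonnegative. -/
lemma S_nonneg (hν : ∀ x, 0 ≤ ν x) (hf0 : ∀ x, 0 ≤ f x) (k : α × α) : 0 ≤ S ν f a b k :=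
  sum_nonneg fun x _ => mul_nonneg (hν x) (hf0 x)

/-- Fibre means of a nonnegative function are nonnegative. -/
lemma fmean_nonneg (hν : ∀ x, 0 ≤ ν x) (hf0 : ∀ x, 0 ≤ f x) (k : α × α) :
    0 ≤ fmean ν f a b k :=
  div_nonneg (S_nonneg hν hf0 k) (M_nonneg hν k)

/-- The fibre-mean function of a nonnegative function is nonnegative. -/
lemma F_nonneg (hν : ∀ x, 0 ≤ ν x) (hf0 : ∀ x, 0 ≤ f x) (x : α) : 0 ≤ F ν f a b x :=
  fmean_nonneg hν hf0 _

/-- A point weighs at most its fibre. -/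
lemma nu_le_M (hν : ∀ x, 0 ≤ ν x) (x : α) : ν x ≤ M ν a b (rho a b x) :=
  single_le_sum (fun y _ => hν y) (mem_fib.mpr rfl)

/-- On a massless fibre every weight vanishes. -/
lemma nu_eq_zero_of_M (hν : ∀ x, 0 ≤ ν x) {k : α × α} (hM : M ν a b k = 0) {x : α}
    (hx : x ∈ fib a b k) : ν x = 0 :=
  (sum_eq_zero_iff_of_nonneg (fun y _ => hν y)).mp hM x hx

/-- On a massless fibre the fibre sum vanishes. -/
lemma S_eq_zero_of_M (hν : ∀ x, 0 ≤ ν x) {k : α × α} (hM : M ν a b k = 0) :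
    S ν f a b k = 0 :=
  sum_eq_zero fun x hx => by rw [nu_eq_zero_of_M hν hM hx, zero_mul]

/-- `fmean k * M k = S k` (also on massless fibres). -/
lemma fmean_mul_M (hν : ∀ x, 0 ≤ ν x) (k : α × α) :
    fmean ν f a b k * M ν a b k = S ν f a b k := by
  by_cases hM : M ν a b k = 0
  · rw [hM, mul_zero, S_eq_zero_of_M hν hM]
  · rw [fmean, div_mul_cancel₀ _ hM]

/-- Summing over the fibres: `∑ x, φ x = ∑ k, ∑_{x ∈ fib k} φ x`. -/
lemma sum_fib (φ : α → ℝ) : ∑ x, φ x = ∑ k, ∑ x ∈ fib a b k, φ x :=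
  (sum_fiberwise univ (rho a b) φ).symm

/-- The fibre-mean function has the same `ν`-integral as `f`. -/
lemma sum_nu_F (hν : ∀ x, 0 ≤ ν x) :
    ∑ x, ν x * F ν f a b x = ∑ x, ν x * f x := by
  rw [sum_fib (a := a) (b := b) (fun x => ν x * F ν f a b x),
    sum_fib (a := a) (b := b) (fun x => ν x * f x)]
  refine sum_congr rfl fun k _ => ?_
  have h : ∀ x ∈ fib a b k, ν x * F ν f a b x = ν x * fmean ν f a b k := by
    intro x hx
    rw [F, mem_fib.mp hx]
  rw [sum_congr rfl h, ← sum_mul, mul_comm]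
  exact fmean_mul_M hν k


end Sums

end

end BoxUnion

end Summit.Ventures.PercRepro2
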